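import Summits.BirchSwinnertonDyer.BirchSwinnertonDyer.Theorems.AdditiveBranchIMCGenusKolyvaginNonsplitSign
import Summits.BirchSwinnertonDyer.Rank1Residual.X11b.NeronIdentityReceptacle
import Literature.NumberTheory.EllipticCurves.NonsingularReductionEmbedding
import Literature.NumberTheory.EllipticCurves.NonsplitProofs
import HarnessLib

/-!
# Route `AdditiveBranchIMC`, cruxes `GordTwoRankZeroOffCaseOne` (stmt-BirchSwinnertonDyer-19357) ∕ `MultLower` (19359),
# lines `three_field_road` ∕ `tame_roads_mult`, stub `stub_nonsplitFrobeniusSign[M]` (L2): THE RECEPTACLE FORM —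
# `F • Q + Q ∈ X11b.E0Receptacle X v` at a non-split multiplicative place

Cell `bsd-addord` (run/shared/lean/pub/bsd-addord/), seat `cruxlead-19357-g3` (continuation lead), HELPER
(`--supports stmt-BirchSwinnertonDyer-19357`). Sequel of `AdditiveBranchIMCGenusKolyvaginNonsplitSign` (the sign theorem
`frobenius_map_add_reducesToNonsingular_of_nonsplitNormalForm` on the non-split normal form `N` over `𝓞_v`). Here:

* `frobenius_smul_add_mem_E0Receptacle_of_not_hasSplitMultiplicativeReductionAt` — LITERALLY the registered signature of
  `stub_nonsplitFrobeniusSign` (crux 19357, `three_field_road` v13) and `stub_nonsplitFrobeniusSignM` (crux 19359,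
  `tame_roads_mult` v13): for `X/K` elliptic over a number field, `v` a finite place of multiplicative, NOT split
  multiplicative reduction, `𝔐 ∈ v.localPrimesAbove`, `F` with `IsArithFrobAt 𝓞_v F 𝔐`, and an `I_𝔐`-fixed
  `Q ∈ X(K̄_v) = localPoints X K_v`: `F • Q + Q ∈ X11b.E0Receptacle X v`. Proof: the minimal model `M = X.localMinimalIntegralModel v`
  has `Δ ∈ 𝓂_v ∌ c₄` and a node polynomial without `k_v`-root (`LocalIndex.noroot_of_not_splits`), hence a non-split normal form
  `N = D • M` (`LocalIndex.exists_smul_nonsplitNormalForm`; `𝓞_v` henselian, `k_v` finite); the sign theorem on `N(K̄_v)` is carried to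
  `X(K̄_v)` along the `Γ_{K_v}`-equivariant substitution `X(K̄_v) ≃ (X ⊗ K_v)(K̄_v) ≃ (M ⊗ K_v)(K̄_v) ≃ (N ⊗ K_v)(K̄_v)`
  (`congrEquiv`, `pointEquivBaseChange` for the chosen `C₀` of the receptacle and for `D`), under which the receptacle is `E₀` of
  `N` for `|·|_v` (`hasNonsingularReduction_variableChange_some_iff` for the `𝒪_w`-integral `D`,
  `reducesToNonsingular_iff_hasNonsingularReduction`) — verbatim the transport of the tree's
  `TateComponent.exists_componentHom_localPoints` (split case, Tate normal form).

THEOREMS ONLY; no `sorry`; nothing about BSD is proved here; the cruxes stay OPEN (three stubs remain on each line: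
residual [by design], printedFacts [cite-only], tameJointLower [sibling line]).

References: [cite: SilvermanATAEC1994, Cor. IV.9.2 (d), Thm. IV.9.4 Step 2] [cite: SilvermanAEC2009, App. C Thm. 15.2,
VII.1 Prop. 1.3 (b), VII.§2 Prop. 2.1] [cite: McCallumLMS1991, Lemma 4.3 (proof)].

presearch: as in the prequel — the statement is Silverman ATAEC IV.9.2 (d)/IV.9.4 Step 2 (Frobenius `= −1` on `Φ_v` at a non-split
node); tree `lean search 'E0Receptacle|nonsplit.*Frobenius'` → only the exponent form `X11b.ordMinimalDiscriminant_nsmul_mem_E0Receptacle`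
and the SPLIT-case transport `TateComponent.exists_componentHom_localPoints`; no receptacle-level sign statement existed.
-/

noncomputable section

open scoped Classical NNReal
open NumberField IsDedekindDomain Field IsLocalRing

universe u

set_option linter.dupNamespace false

namespace Summit.BirchSwinnertonDyer.BirchSwinnertonDyer.Theorems.GenusKolyvagin.NonsplitSign

open Literature.NumberTheory.EllipticCurves Literature.NumberTheory.EllipticCurves.LocalIndex
  Literature.NumberTheory.GaloisRepresentations
  Literature.NumberTheory.GaloisRepresentations.IsNonarchimedeanLocalField
  IsDedekindDomain.HeightOneSpectrum WeierstrassCurve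

/-! ## The receptacle form: the registered signature of `stub_nonsplitFrobeniusSign[M]` -/

open Summit.BirchSwinnertonDyer.Rank1Residual.X11b in
set_option maxHeartbeats 1600000 in
/-- **At a non-split multiplicative place the arithmetic Frobenius acts as `−1` on `X(K_v^{un})/X⁰(K_v^{un})`**,
receptacle form — LITERALLY the registered statement of `stub_nonsplitFrobeniusSign` (crux 19357, line
`three_field_road`) and `stub_nonsplitFrobeniusSignM` (crux 19359, line `tame_roads_mult`): `X/K` elliptic over a
number field, `v` a finite place of multiplicative, NOT split multiplicative reduction, `𝔐` a prime of `\bar 𝓞_v`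
above `𝓂_v`, `F ∈ Γ_{K_v}` an arithmetic Frobenius at `𝔐`; then for every `Q ∈ X(K̄_v)` fixed by the inertia group
`I_𝔐`, `F • Q + Q ∈ E⁰(K̄_v) = X11b.E0Receptacle X v`. Transport of
`frobenius_map_add_reducesToNonsingular_of_nonsplitNormalForm` from the non-split normal form `N = D • M` of the
minimal model `M = X.localMinimalIntegralModel v` (tree `LocalIndex.exists_smul_nonsplitNormalForm`, `𝓞_v` henselian
with finite residue field; non-splitness = no `k_v`-root of the node polynomial, `LocalIndex.noroot_of_not_splits`)
along the `Γ_{K_v}`-equivariant substitution `X(K̄_v) ≃ (M ⊗ K_v)(K̄_v) ≃ (N ⊗ K_v)(K̄_v)` of the receptacle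
(`pointEquivBaseChange`, `congrEquiv`; the receptacle is `E₀` of `N` for `|·|_v` by
`hasNonsingularReduction_variableChange_some_iff`), exactly as in the tree's
`TateComponent.exists_componentHom_localPoints`. Kodaira–Néron–Tate: Silverman *ATAEC* Cor. IV.9.2 (d),
Thm. IV.9.4 Step 2; *AEC* Thm. C.15.2. [cite: SilvermanATAEC1994, Cor. IV.9.2 (d), Thm. IV.9.4 Step 2]
[cite: SilvermanAEC2009, App. C Thm. 15.2, VII.§2 Prop. 2.1] [cite: McCallumLMS1991, Lemma 4.3 (proof)] -/
theorem frobenius_smul_add_mem_E0Receptacle_of_not_hasSplitMultiplicativeReductionAt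
    (K : Type) [Field K] [NumberField K] (X : WeierstrassCurve K) [X.IsElliptic] (v : HeightOneSpectrum (𝓞 K))
    (hmult : X.HasMultiplicativeReductionAt v) (hns : ¬ X.HasSplitMultiplicativeReductionAt v)
    (𝔐 : Ideal v.localAbsIntegers) (h𝔐 : 𝔐 ∈ v.localPrimesAbove) (F : absoluteGaloisGroup (v.adicCompletion K))
    (hF : IsArithFrobAt (v.adicCompletionIntegers K) F 𝔐) (Q : localPoints X (v.adicCompletion K))
    (hQ : ∀ σ ∈ 𝔐.inertia (absoluteGaloisGroup (v.adicCompletion K)), σ • Q = Q) :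
    F • Q + Q ∈ E0Receptacle X v := by
  -- the chosen spectral valuation and structure map of the receptacle
  set w := (v.exists_spectralValuation).choose with hwdef
  have hw : ∀ z, (w z : ℝ) = spectralNorm (v.adicCompletion K) (AlgebraicClosure (v.adicCompletion K)) z :=
    (v.exists_spectralValuation).choose_spec
  set ι₀ := (exists_ringHom_adicCompletionIntegers_integer (v.exists_spectralValuation).choose_spec).choose
    with hι₀def
  have hι : ∀ a, ((ι₀ a : w.integer) : AlgebraicClosure (v.adicCompletion K)) =
      algebraMap (v.adicCompletion K) (AlgebraicClosure (v.adicCompletion K)) (a : v.adicCompletion K) :=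
    (exists_ringHom_adicCompletionIntegers_integer (v.exists_spectralValuation).choose_spec).choose_spec
  -- the minimal model `M`, the chosen `C₀ • X_{K_v} = M ⊗ K_v`, and the non-split normal form `N = D • M`
  set M := X.localMinimalIntegralModel v with hMdef
  set C₀ := (X.exists_variableChange_eq_localMinimalIntegralModel v).choose with hC₀def
  have hC₀ : C₀ • X.baseChange (v.adicCompletion K) =
      M.map (algebraMap (v.adicCompletionIntegers K) (v.adicCompletion K)) :=
    (X.exists_variableChange_eq_localMinimalIntegralModel v).choose_spec
  obtain ⟨hΔm, hc₄m⟩ := (X.hasMultiplicativeReductionAt_iff_mem v).mp hmult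
  rw [← hMdef] at hΔm hc₄m
  have hnoroot := LocalIndex.noroot_of_not_splits M hc₄m fun hsplit ↦ hns (by
    haveI : (X.localMinimalModel v).HasMultiplicativeReduction (v.adicCompletionIntegers K) := hmult
    exact ⟨hsplit⟩)
  haveI : HenselianLocalRing (v.adicCompletionIntegers K) := inferInstance
  haveI : PerfectField (ResidueField (v.adicCompletionIntegers K)) := PerfectField.ofFinite
  obtain ⟨D, h3, h4, h6, hb₂, hani⟩ := LocalIndex.exists_smul_nonsplitNormalForm M hΔm hc₄m hnoroot
  set N := D • M with hNdef
  -- `D` over `K_v`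
  set D' := D.map (algebraMap (v.adicCompletionIntegers K) (v.adicCompletion K)) with hD'def
  have hDK : D' • M.map (algebraMap (v.adicCompletionIntegers K) (v.adicCompletion K)) =
      N.baseChange (v.adicCompletion K) := by
    change _ = (D • M).map (algebraMap (v.adicCompletionIntegers K) (v.adicCompletion K))
    rw [map_variableChange]
  -- the transport `Ψ : X(K̄_v) ≃ N(K̄_v)`
  let Ψ := (Affine.Point.congrEquiv (baseChange_baseChange_adicCompletion X v).symm).trans <|
      (VariableChange.pointEquivBaseChange (X.baseChange (v.adicCompletion K)) C₀
          (AlgebraicClosure (v.adicCompletion K))).trans <|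
        (Affine.Point.congrEquiv (congrArg (fun Y : WeierstrassCurve (v.adicCompletion K) ↦
            Y.baseChange (AlgebraicClosure (v.adicCompletion K))) hC₀)).trans <|
          (VariableChange.pointEquivBaseChange
              (M.map (algebraMap (v.adicCompletionIntegers K) (v.adicCompletion K))) D'
              (AlgebraicClosure (v.adicCompletion K))).trans
            (Affine.Point.congrEquiv (congrArg (fun Y : WeierstrassCurve (v.adicCompletion K) ↦
              Y.baseChange (AlgebraicClosure (v.adicCompletion K))) hDK))
  let ΨL : localPoints X (v.adicCompletion K) ≃+
      ((N.baseChange (v.adicCompletion K)).baseChange (AlgebraicClosure (v.adicCompletion K))).toAffine.Point := Ψ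
  have hΨL : ∀ P : localPoints X (v.adicCompletion K), ΨL P = Ψ P := fun _ ↦ rfl
  -- `Ψ` is `Γ_{K_v}`-equivariant
  have hΨσ : ∀ (σ : absoluteGaloisGroup (v.adicCompletion K)) (P : localPoints X (v.adicCompletion K)),
      Ψ (σ • P) = Affine.Point.map ((absoluteGaloisGroup.toAlgEquiv _ σ :
          AlgebraicClosure (v.adicCompletion K) ≃ₐ[v.adicCompletion K] AlgebraicClosure (v.adicCompletion K)) :
          AlgebraicClosure (v.adicCompletion K) →ₐ[v.adicCompletion K] AlgebraicClosure (v.adicCompletion K)) (Ψ P) := by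
    intro σ P
    simp only [Ψ, AddEquiv.trans_apply]
    rw [WeierstrassCurve.congrEquiv_smul X v σ P, VariableChange.pointEquivBaseChange_map_algEquiv,
      Affine.Point.congrEquiv_baseChange_map hC₀, VariableChange.pointEquivBaseChange_map_algEquiv,
      Affine.Point.congrEquiv_baseChange_map hDK]
  -- the receptacle is `E₀` of `N` for the spectral valuation, through `Ψ`
  have hXe : (N.baseChange (v.adicCompletion K)).baseChange (AlgebraicClosure (v.adicCompletion K)) =
      (N.map ι₀).baseChange (AlgebraicClosure (v.adicCompletion K)) :=
    baseChange_map_eq_baseChange_map_choose v N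
  have hV : (D.map ι₀) • (M.map ι₀) = N.map ι₀ := by rw [hNdef, map_variableChange]
  have hDι : (D.map ι₀).map (algebraMap w.integer (AlgebraicClosure (v.adicCompletion K))) =
      D'.map (algebraMap (v.adicCompletion K) (AlgebraicClosure (v.adicCompletion K))) := by
    rw [VariableChange.map_map, hD'def, VariableChange.map_map]
    congr 1
    exact RingHom.ext fun a ↦ hι a
  have hE0 : ∀ P : localPoints X (v.adicCompletion K),
      P ∈ E0Receptacle X v ↔ ReducesToNonsingular w (IsLocalRing.residue w.integer) (Ψ P) := by
    intro P
    rcases P with _ | ⟨x, y, h⟩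
    · change (0 : localPoints X (v.adicCompletion K)) ∈ E0Receptacle X v ↔
        ReducesToNonsingular w (IsLocalRing.residue w.integer) (Ψ 0)
      rw [map_zero]
      exact ⟨fun _ ↦ reducesToNonsingular_zero, fun _ ↦ zero_mem_E0Receptacle X v⟩
    · rw [mem_E0Receptacle_iff]
      simp only [Ψ, AddEquiv.trans_apply, Affine.Point.congrEquiv_some,
        VariableChange.pointEquivBaseChange_some]
      rw [← Literature.NumberTheory.EllipticCurves.reducesToNonsingular_congrEquiv_iff
        (r := IsLocalRing.residue w.integer) (h := hXe),
        Affine.Point.congrEquiv_some, reducesToNonsingular_iff_hasNonsingularReduction (N.map ι₀)]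
      refine (hasNonsingularReduction_variableChange_some_iff (M.map ι₀) (D.map ι₀) hV ?_ ?_ _ _).symm
      · rw [hDι]
      · rw [hDι]
  -- conclude on `N(K̄_v)`
  rw [hE0, ← hΨL, map_add, hΨL, hΨL, hΨσ]
  exact frobenius_map_add_reducesToNonsingular_of_nonsplitNormalForm hw h𝔐 N h3 h4 h6 hb₂ hani hF (Ψ Q)
    fun τ hτ ↦ by rw [← hΨσ, hQ τ hτ]

end Summit.BirchSwinnertonDyer.BirchSwinnertonDyer.Theorems.GenusKolyvagin.NonsplitSign

end
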